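import Literature.AlgebraicGeometry.Milne1999.SpecialLefschetzGroupInvariantsQuaternionPowers
import Literature.AlgebraicGeometry.Milne1999.SpecialLefschetzGroupInvariantsFormBlocksMultiplicity
import HarnessLib

/-!
# Milne 1999, Cor. 4.5 / Thm. 3.2 / Prop. 3.6 (a), (b) with multiplicity, §2 "type III" (and type II in the
# CM presentation): the `S`-invariants of ALL POWERS of a complex abelian variety with quaternionic
# multiplication whose polarization pairs the two halves `V_{σ₁}`, `V_{σ₂} = κ^* V_{σ₁}` are Lefschetz classes

Family `hodge`, layer `Literature/AlgebraicGeometry/Milne1999`, namespace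
`Literature.AlgebraicGeometry.Milne1999` (D-0022). THEOREMS ONLY (no definition, no named fact, no `sorry`;
D-0026, net debt 0). Written for the cell `pub-hodgecm2` (COR-CM), seat `lit-milne`, binder table
`HOME/lit/milne.md` rows M2/M4 (the record `Milne1999_specialLefschetzGroup_invariants_le` of
`Milne1999/LefschetzGroup`: Cor. 4.5 with Thm. 4.4 and Thm. 3.2, whose CONCLUSION is proved here on a new
locus; its wording is untouched and it is NOT discharged). Sequel of
`Milne1999/SpecialLefschetzGroupInvariantsQuaternionPowers` (type II in the symmetric presentation: the
eigenspaces of a SELF-ADJOINT `ψ^*` are pairwise `Q_h`-orthogonal symplectic blocks linked by `κ^*`) and of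
`Milne1999/SpecialLefschetzGroupInvariantsFormBlocksMultiplicity` (the several-blocks criterion for blocks of
both kinds, through the tensor FFT for `O` AND `Sp`, and the two-family crossed classes). Here — Milne's own
presentation of types II and III, §2 pp. 649–650 — `ψ` generates the CM subalgebra `L = F[α]`, so that the
polarization form pairs each eigenspace `V_{σ₁}` of `ψ^*` with exactly one OTHER eigenspace
`V_{σ₂} = V_{π(σ₁)}` (`hQπ`), and `κ^* = β^*` links `V_{σ₁} → V_{σ₂}` (`κ^*κ^*` a non-zero scalar blockwise)
and is `ε`-symmetric for `Q_h`: the bilinear form `(x, y) ↦ Q_h(x, κ^*y)` on `V_{σ₁}` is SYMMETRIC for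
`ε = −1` (`β† = −β`, type III: "`S(A)_{k^al} ≅ ∏ O(φ_{2,σ₁})`") and ALTERNATING for `ε = 1` (`β† = β`, type II:
"`∏ Sp(φ_{2,σ₁})`"), `S(A)(ℂ) ⊇ ∏_{{σ₁,σ₂}} G(V_{σ₁})` acting on `V_{σ₁}` by the standard representation and on
`V_{σ₂} = κ^*V_{σ₁}` by its `κ^*`-transport ("standard ⊕ contragredient"), and the several-blocks criterion
gives the conclusion of the record on every power `A^{N+1}`. No new invariant theory beyond
`OrthogonalTensorFFTColoured`.

## Source, verbatim

J. S. Milne, *Lefschetz classes on abelian varieties*, Duke Math. J. 96 (1999) 639–675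
[`paper:doi-10-1215-s0012-7094-99-09620-5`, held; PDF page = printed page − 638]:

* §1 p. 643: "For any positive integer `r`, `V(A^r) = rV(A)`, and the diagonal action of `C(A)` on `rV(A)`
  identifies `C(A)` with `C(A^r)`"; p. 644: "`S(A)` is the largest algebraic subgroup of `Sp(e_D)` whose
  elements commute with the endomorphisms of `A`".
* §2 pp. 649–650 (p0011 L35–p0012 L52): "Simple abelian variety of type II. […] basis `1, α, β, αβ` for `E`
  with `α² = a ∈ F` […], `β² = b ∈ F` […], `αβ = −βα`. […] Let `L = F[α]`. […] `φ(x, y) = φ₁(x, y) + φ₂(x, y)β`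
  […] Let `σ₁, σ₂ : L → k^{al}` be the extensions of `σ` to `L`. Then `V_σ = V_{σ₁} ⊕ V_{σ₂}` […] and
  `γ ↦ γ|V_{σ₁}` identifies `U(φ_{1,σ}) ∩ Sp(φ_{2,σ})` with `Sp(φ_{2,σ₁})`. The representation of `Sp(φ_{2,σ₁})` on
  `V_{σ₁}` is its standard representation, and its representation on `V_{σ₂}` is the contragredient of the
  standard representation (which is isomorphic to the standard representation). Simple abelian variety of
  type III. This is similar to the preceding case […] the ample divisor `D` is chosen so that its Rosati
  involution is the standard involution. […] In this case `β† = −β`, and `S(A) = ∏ᵢ Res_{Fᵢ/k} U(φ_{1,i}) ∩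
  Res_{Lᵢ/k} O(φ_{2,i})` with `φ_{1,i}` a skew-Hermitian form […] and `φ_{2,i}` an `Lᵢ`-bilinear symmetric form.
  Moreover `S(A)_{k^al} ≅ ∏ O(φ_{2,σ₁})` where the product is indexed by the embeddings `σ: F → k^al` […] The
  representation of `O(φ_{2,σ₁})` on `V_{σ₁} = V(A) ⊗_{L,σ₁} k^al` is its standard representation, and its
  representation on `V_{σ₂}` is the contragredient of the standard representation (which is isomorphic to
  the standard representation)."
* pp. 654–655 "The symplectic group", "The orthogonal group. Let `φ` be a nondegenerate symmetric bilinear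
  form on `V`, and let `G = O(φ)` […]"; Prop. 3.6 (p. 655): "`(⋀^*(rH))^G = k[(⊗² rH)^G]` all `r ≥ 1` […]
  (a) `G = Sp(φ)` […]; (b) `G = O(φ)` […]"; p. 656: "`(⋀^*(⊕ rH_σ))^{∏S_σ} = ⊗_σ (⋀^* rH_σ)^{S_σ}` […]";
  Props. 3.3–3.4, Remark 3.7; Cor. 4.5, Cor. 4.7 (p. 659), Prop. 4.8 (p. 660).

## What is proved (complex `A`, Betti cohomology, the tree's carriers)

* §1 `eq_sum_block_of_mem_eigenspace` and the adapted basis **`exists_linkedPairBlockBasis`**: for a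
  diagonalisable `J` with equidimensional eigenspaces and a `K` with `K V_μ ⊆ V_{π μ}` (`π μ ≠ μ`) and
  `K² = c_μ ≠ 0` on `V_μ` — an eigenbasis `b(ℓ, k)`, a fixed-point-free involution `τ` of the blocks with
  `π(μ_k) = μ_{τ k}` and `K b(ℓ, k) = c_k b(ℓ, τ k)` (the letters of `V_{σ₂}` are the `κ^*`-translates of those
  of `V_{σ₁}`; no bilinear form enters).
* §2 **`mem_divisorClassesSpan_powSucc_of_forall_exteriorPullback_eq_of_quaternionDual`** — the `S(ℂ)`-form
  for every power `A^{N+1}`: the several-blocks criterion `…_of_formBlocks` on the letters `prⱼ^* b(ℓ, k)`,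
  colour of the slot `(j, k)` = the pair `{k, τ k}` (coded `min k (τ k)`), `Θ_k` = the matrix
  `(λQ_h(b(ℓ,k), b(ℓ',τk)))` of the duality `V_k × V_{τ k} → ℂ` (`Θ_kᵀ = −ε Θ_k`, `Θ_{τ k} = ε Θ_k`,
  non-degenerate); for `g ∈ G(Θ_k)` the automorphism acting by `g` on `V_k` AND on `V_{τ k}` (same matrix on
  the transported letters) and trivially elsewhere preserves `Q_h`, commutes with `ψ^*` and `κ^*`, so lies in
  `S(A)(ℂ)` (`hC`), and its diagonal image (`diagPow`) acts on all slots of that colour by `g`; the divisor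
  class of the pair is `θ_k = ∑ (Θ_k⁻¹)_{ac} b(a,k) ⌣ b(c,τk) ∈ B¹(A) ⊗ ℂ` (fixed by every `u ∈ S(A)(ℂ)`:
  `M Θ_k⁻¹ Mᵀ = Θ_k⁻¹`; Prop. 3.3 in the `S(ℂ)`-form `mem_hodgeClassSpan_of_forall_exteriorPullback_eq`), and
  the crossed classes of two slots `(j, k)`, `(j', k')`, `k' ∈ {τ k, k}`, are
  `∑ (Θ_k⁻¹)_{ac} prⱼ^* b(a,k) ⌣ pr_{j'}^* b(c,τk)` and `(c_{τk})⁻¹ ∑ (Θ_k⁻¹)_{ac} prⱼ^* b(a,k) ⌣ (pr_{j'} ≫ κ)^* b(c,τk)`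
  — divisor classes by the SEPARATION lemma `FormBlocksMultiplicity.sum_smul_cross₂_mem_span_rational_oneOne`
  (`ψ^*` has different eigenvalues `μ_k ≠ μ_{τk}` on the two families).
* `polarizationPairingOne_eq_zero_of_mem_eigenspace_of_adjoint` — the hypothesis `hQπ` from an adjoint pair
  `Q_h(ψ^*x, y) = Q_h(x, ψ'^*y)` (for types II/III: `ψ' = ψ†` the Rosati conjugate in `L`).
* **`exists_polarization_invariants_le_powSucc_of_quaternionDual`** (the package consumed by
  `SpecialLefschetzGroupInvariantsFiniteProducts`),
  **`specialLefschetzGroup_invariants_le_powSucc_of_quaternionDual`** — the CONCLUSION of the record for every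
  power `A^{N+1}`; `…_of_isIsogenous_powSucc_of_quaternionDual` (Cor. 4.7); Cor. 4.5 as an equality of sets;
  Prop. 4.8 (c) ⇒ (a) on `A^{N+1}`.

NOT here: the derivation of the hypotheses from "`End⁰(A)` is a quaternion algebra over a totally real field
with the standard involution positive" (Albert type III) — i.e. the choice of `ψ ∈ L = F[α]` generating `L`,
of `ψ' = ψ†`, `π`, and of `κ = β`; products of non-isogenous such varieties (the finite-products file
consumes the package); type IV; the record itself.

## References

* [Milne1999LefschetzClasses] J. S. Milne, Lefschetz classes on abelian varieties, Duke Math. J. 96 (1999)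
  639–675: §1 pp. 643–644, §2 pp. 646–650 (types II and III), pp. 654–655, Props. 3.3–3.4, 3.6 (a), (b),
  Remark 3.7, p. 656, Thm. 4.4, Cor. 4.5, Cor. 4.7 (p. 659), Prop. 4.8 (p. 660).
* [GoodmanWallachGTM255] R. Goodman, N. R. Wallach, GTM 255 (2009), §1.1.2, Thm. 5.3.3 (1), (2), Thm. 5.3.5,
  (5.34), §4.1.1.
* [LangeBirkenhake1992] H. Lange, Ch. Birkenhake, Complex Abelian Varieties (1992), §5.5 (endomorphism
  algebras of types II and III, Rosati involutions on quaternion algebras).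
* [MumfordAV1970] D. Mumford, Abelian Varieties (1970), §21 (Albert's classification, types II and III).
-/

noncomputable section

open scoped BigOperators Matrix
open CategoryTheory
open Literature.AlgebraicTopology.SingularHomology
open Literature.AlgebraicGeometry.HodgeTheory
open Literature.AlgebraicGeometry.Motives
open Literature.AlgebraicGeometry.VanGeemen1994 (pullbackOne hodgeClassSpan)
open Literature.Barriers.HodgeConjecture (divisorClassesSpan divisorMonomials mem_divisorMonomials_zero)
open Literature.Geometry.Kaehler (lefschetzPow)
open Literature.RepresentationTheory.GeneralLinear
open Literature.RepresentationTheory.ClassicalInvariants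
open Literature.NumberTheory.DiophantineGeometry

namespace Literature.AlgebraicGeometry.Milne1999

/-! ### §1 Linear algebra: the eigenbasis with linked pairs of blocks, transported by `κ^*` -/

section LinkedPairs

variable {V : Type*} [AddCommGroup V] [Module ℂ V] {N₁ m : ℕ}

/-- A non-zero vector lies in at most one eigenspace. [folklore] -/
private theorem eigenvalue_eq_of_mem_of_mem' {J : Module.End ℂ V} {a a' : ℂ} {v : V}
    (ha : v ∈ J.eigenspace a) (ha' : v ∈ J.eigenspace a') (hv : v ≠ 0) : a = a' := by
  rw [Module.End.mem_eigenspace_iff] at ha ha'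
  have h : (a - a') • v = 0 := by rw [sub_smul, ← ha, ← ha', sub_self]
  exact sub_eq_zero.1 ((smul_eq_zero.1 h).resolve_right hv)

/-- **An eigenvector for `μ_k` has coordinates only in block `k`** of an eigenbasis with distinct
eigenvalues: `v = ∑_ℓ v_{(ℓ,k)} b(ℓ,k)`. [cite: Milne1999LefschetzClasses, §2 p. 646 (`V = ⊕ V_σ`)] -/
theorem eq_sum_block_of_mem_eigenspace (b : Module.Basis (Fin N₁ × Fin m) ℂ V) (J : Module.End ℂ V)
    {μ : Fin m → ℂ} (hμ : Function.Injective μ) (hJb : ∀ ℓ k, J (b (ℓ, k)) = μ k • b (ℓ, k))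
    {k : Fin m} {v : V} (hv : v ∈ J.eigenspace (μ k)) :
    v = ∑ ℓ, b.repr v (ℓ, k) • b (ℓ, k) := by
  classical
  have hzero : ∀ ℓ' k', k' ≠ k → b.repr v (ℓ', k') = 0 := by
    intro ℓ' k' hk'
    rw [Module.End.mem_eigenspace_iff] at hv
    have hexp : J v = ∑ i, (μ i.2 * b.repr v i) • b i := by
      conv_lhs => rw [← b.sum_repr v, map_sum]
      refine Finset.sum_congr rfl fun i _ => ?_
      obtain ⟨ℓ₀, k₀⟩ := i
      rw [map_smul, hJb, smul_smul, mul_comm]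
    have h1 : b.repr (J v) (ℓ', k') = μ k' * b.repr v (ℓ', k') := by
      rw [hexp, b.repr_sum_self]
    have h2 : b.repr (J v) (ℓ', k') = μ k * b.repr v (ℓ', k') := by
      rw [hv, map_smul, Finsupp.smul_apply, smul_eq_mul]
    have h3 : (μ k' - μ k) * b.repr v (ℓ', k') = 0 := by rw [sub_mul, ← h1, ← h2, sub_self]
    rcases mul_eq_zero.1 h3 with h | h
    · exact absurd (hμ (sub_eq_zero.1 h)) hk'
    · exact h
  conv_lhs => rw [← b.sum_repr v, Fintype.sum_prod_type]
  refine Finset.sum_congr rfl fun ℓ' _ => ?_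
  rw [Finset.sum_eq_single k]
  · intro k' _ hk'
    rw [hzero ℓ' k' hk', zero_smul]
  · intro h
    exact absurd (Finset.mem_univ k) h

variable [FiniteDimensional ℂ V]

/-- **The eigenbasis with linked pairs of blocks, transported by the linking endomorphism** (Milne's
"`V_σ = V_{σ₁} ⊕ V_{σ₂}` […] the representation […] on `V_{σ₁}` is its standard representation, and its
representation on `V_{σ₂}` is the contragredient", §2 p. 650, types II and III). Let `J` be diagonalisable with
all eigenspaces of dimension `N₁`, and `K` with `K V_μ ⊆ V_{π(μ)}`, `π(μ) ≠ μ` for eigenvalues `μ`, and `K ∘ K`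
a non-zero scalar on every `V_μ`. Then there are distinct eigenvalues `μ_k` (`k ∈ Fin m`), a fixed-point-free
involution `τ` of `Fin m` with `π(μ_k) = μ_{τ k}`, non-zero scalars `c_k` and a basis `b(ℓ, k)` (`ℓ ∈ Fin N₁`)
with `J b(ℓ,k) = μ_k b(ℓ,k)` and `K b(ℓ,k) = c_k b(ℓ, τ k)` (the letters of one block of each pair are the
`K`-translates of those of the other). No bilinear form enters.
[cite: Milne1999LefschetzClasses, §2 pp. 649–650 (types II, III: `V_σ = V_{σ₁} ⊕ V_{σ₂}`)] -/
theorem exists_linkedPairBlockBasis (J K : Module.End ℂ V) (hJ : ⨆ μ, J.eigenspace μ = ⊤)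
    (hV : 0 < Module.finrank ℂ V)
    (hn : ∀ μ, J.HasEigenvalue μ → Module.finrank ℂ (J.eigenspace μ) = N₁)
    (π : ℂ → ℂ) (hπ : ∀ μ, J.HasEigenvalue μ → π μ ≠ μ)
    (hlink : ∀ μ v, v ∈ J.eigenspace μ → K v ∈ J.eigenspace (π μ))
    (hK2 : ∀ μ, ∃ c : ℂ, c ≠ 0 ∧ ∀ v ∈ J.eigenspace μ, K (K v) = c • v) :
    ∃ (m : ℕ) (μ : Fin m → ℂ) (τ : Fin m → Fin m) (b : Module.Basis (Fin N₁ × Fin m) ℂ V) (c : Fin m → ℂ),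
      Function.Injective μ ∧ (∀ k, τ (τ k) = k) ∧ (∀ k, τ k ≠ k) ∧ (∀ k, π (μ k) = μ (τ k)) ∧
      (∀ ℓ k, J (b (ℓ, k)) = μ k • b (ℓ, k)) ∧
      (∀ k, c k ≠ 0) ∧ (∀ ℓ k, K (b (ℓ, k)) = c k • b (ℓ, τ k)) := by
  classical
  obtain ⟨m, μ, b₀, hμ, hJb, -⟩ := exists_uniformBlockEigenbasis (0 : LinearMap.BilinForm ℂ V) J hJ
    (fun _ _ => rfl) N₁ hn
  -- the blocks are non-empty
  have hN₁ : 0 < N₁ := by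
    have h := Module.finrank_eq_card_basis b₀
    rw [Fintype.card_prod, Fintype.card_fin, Fintype.card_fin] at h
    refine Nat.pos_of_ne_zero fun h0 => ?_
    rw [h, h0, zero_mul] at hV
    exact lt_irrefl 0 hV
  set ℓ₀ : Fin N₁ := ⟨0, hN₁⟩ with hℓ₀
  have hb0 : ∀ ℓ k, b₀ (ℓ, k) ≠ 0 := fun ℓ k => b₀.ne_zero _
  have hmem₀ : ∀ ℓ k, b₀ (ℓ, k) ∈ J.eigenspace (μ k) := fun ℓ k =>
    Module.End.mem_eigenspace_iff.2 (hJb ℓ k)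
  have hev : ∀ k, J.HasEigenvalue (μ k) := fun k =>
    Module.End.hasEigenvalue_of_hasEigenvector ⟨hmem₀ ℓ₀ k, hb0 _ _⟩
  -- the scalars `K² = bK k` on the blocks
  choose bK hbK0 hbK using fun k => hK2 (μ k)
  have hKne : ∀ {k : Fin m} {v : V}, v ∈ J.eigenspace (μ k) → v ≠ 0 → K v ≠ 0 := by
    intro k v hv hv0 hKv
    have e := hbK k v hv
    rw [hKv, map_zero] at e
    exact hv0 ((smul_eq_zero.1 e.symm).resolve_left (hbK0 k))
  -- the involution `τ` of the blocks
  have hτex : ∀ k, ∃ k', π (μ k) = μ k' := fun k =>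
    exists_eq_of_mem_eigenspace b₀ J hJb (hlink _ _ (hmem₀ ℓ₀ k)) (hKne (hmem₀ _ _) (hb0 _ _))
  choose τ hτ using hτex
  have hππ : ∀ k, π (π (μ k)) = μ k := by
    intro k
    have h1 : K (K (b₀ (ℓ₀, k))) ∈ J.eigenspace (π (π (μ k))) := hlink _ _ (hlink _ _ (hmem₀ _ k))
    have h2 : K (K (b₀ (ℓ₀, k))) ∈ J.eigenspace (μ k) := by
      rw [hbK k _ (hmem₀ _ k)]
      exact Submodule.smul_mem _ _ (hmem₀ _ k)
    have h3 : K (K (b₀ (ℓ₀, k))) ≠ 0 := by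
      rw [hbK k _ (hmem₀ _ k)]
      exact smul_ne_zero (hbK0 k) (hb0 _ _)
    exact eigenvalue_eq_of_mem_of_mem' h1 h2 h3
  have hττ : ∀ k, τ (τ k) = k := fun k => hμ (by rw [← hτ (τ k), ← hτ k, hππ])
  have hτne : ∀ k, τ k ≠ k := fun k h => hπ (μ k) (hev k) (by rw [hτ, h])
  have hlt_or : ∀ k, k < τ k ∨ τ k < k := fun k => lt_or_gt_of_ne (hτne k).symm
  have hKmem : ∀ {k : Fin m} {v : V}, v ∈ J.eigenspace (μ k) → K v ∈ J.eigenspace (μ (τ k)) := by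
    intro k v hv
    rw [← hτ]
    exact hlink _ _ hv
  -- the adapted family: `b₀` on the representative blocks `k < τ k`, `K`-translates on the others
  set e : Fin N₁ × Fin m → V := fun i => if i.2 < τ i.2 then b₀ i else K (b₀ (i.1, τ i.2)) with he_def
  have he_if : ∀ ℓ k, k < τ k → e (ℓ, k) = b₀ (ℓ, k) := fun ℓ k h => by
    simp only [he_def, if_pos h]
  have he_else : ∀ ℓ k, ¬ k < τ k → e (ℓ, k) = K (b₀ (ℓ, τ k)) := fun ℓ k h => by
    simp only [he_def, if_neg h]
  have hmem : ∀ ℓ k, e (ℓ, k) ∈ J.eigenspace (μ k) := by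
    intro ℓ k
    by_cases h : k < τ k
    · rw [he_if ℓ k h]
      exact hmem₀ ℓ k
    · rw [he_else ℓ k h]
      have h' := hKmem (hmem₀ ℓ (τ k))
      rwa [hττ] at h'
  have hJe : ∀ ℓ k, J (e (ℓ, k)) = μ k • e (ℓ, k) := fun ℓ k => Module.End.mem_eigenspace_iff.1 (hmem ℓ k)
  -- `K` on the letters
  set c : Fin m → ℂ := fun k => if k < τ k then 1 else bK (τ k) with hc_def
  have hc0 : ∀ k, c k ≠ 0 := by
    intro k
    by_cases h : k < τ k
    · simp only [hc_def, if_pos h]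
      exact one_ne_zero
    · simp only [hc_def, if_neg h]
      exact hbK0 _
  have hKe : ∀ ℓ k, K (e (ℓ, k)) = c k • e (ℓ, τ k) := by
    intro ℓ k
    rcases hlt_or k with h | h
    · have h' : ¬ τ k < τ (τ k) := by
        rw [hττ]
        exact lt_asymm h
      simp only [hc_def, if_pos h]
      rw [he_if ℓ k h, he_else ℓ (τ k) h', hττ, one_smul]
    · have h' : ¬ k < τ k := lt_asymm h
      have h'' : τ k < τ (τ k) := by
        rw [hττ]
        exact h
      simp only [hc_def, if_neg h']
      rw [he_else ℓ k h', he_if ℓ (τ k) h'', hbK (τ k) _ (hmem₀ ℓ (τ k))]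
  -- the family spans: every `b₀ (ℓ, k)` is a combination of the `e`
  have hspan : ⊤ ≤ Submodule.span ℂ (Set.range e) := by
    rw [← b₀.span_eq]
    refine Submodule.span_le.2 ?_
    rintro _ ⟨⟨ℓ, k⟩, rfl⟩
    by_cases h : k < τ k
    · rw [← he_if ℓ k h]
      exact Submodule.subset_span ⟨(ℓ, k), rfl⟩
    · -- `b₀(ℓ,k) = bK⁻¹ K (K b₀(ℓ,k))`, and `K b₀(ℓ,k) ∈ V_{τ k}` expands in block `τ k` of `b₀`
      have hKv : K (b₀ (ℓ, k)) ∈ J.eigenspace (μ (τ k)) := hKmem (hmem₀ ℓ k)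
      have hexp := eq_sum_block_of_mem_eigenspace b₀ J hμ hJb hKv
      have hv : b₀ (ℓ, k) = (bK k)⁻¹ • K (K (b₀ (ℓ, k))) := by
        rw [hbK k _ (hmem₀ ℓ k), smul_smul, inv_mul_cancel₀ (hbK0 k), one_smul]
      rw [hv, hexp, map_sum]
      refine Submodule.smul_mem _ _ (Submodule.sum_mem _ fun ℓ' _ => ?_)
      rw [map_smul]
      refine Submodule.smul_mem _ _ ?_
      have hk : ¬ k < τ k := h
      rw [show K (b₀ (ℓ', τ k)) = e (ℓ', k) from (he_else ℓ' k hk).symm]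
      exact Submodule.subset_span ⟨(ℓ', k), rfl⟩
  have hcard : Fintype.card (Fin N₁ × Fin m) = Module.finrank ℂ V := (Module.finrank_eq_card_basis b₀).symm
  let b : Module.Basis (Fin N₁ × Fin m) ℂ V := basisOfTopLeSpanOfCardEqFinrank e hspan hcard
  have hb : ∀ i, b i = e i := fun i => by
    change (basisOfTopLeSpanOfCardEqFinrank e hspan hcard) i = e i
    rw [coe_basisOfTopLeSpanOfCardEqFinrank]
  refine ⟨m, μ, τ, b, c, hμ, hττ, hτne, hτ, fun ℓ k => ?_, hc0, fun ℓ k => ?_⟩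
  · rw [hb]
    exact hJe ℓ k
  · rw [hb, hb]
    exact hKe ℓ k

end LinkedPairs

/-! ### §2 Prop. 3.6 (a), (b) with multiplicity for the powers of an abelian variety with quaternionic
multiplication, the polarization pairing the linked halves: `S(A)(ℂ) ⊇ ∏_{{σ₁,σ₂}} G(V_{σ₁})`, `G ∈ {O, Sp}` -/

section Main

variable {A : AbelianVariety ℂ}

/-- Two linked pairs of blocks `{k, τ k}`, `{k', τ k'}` with the same smaller element coincide. [folklore] -/
private theorem eq_or_eq_of_min_eq' {m : ℕ} {τ : Fin m → Fin m} (hττ : ∀ k, τ (τ k) = k) {k k' : Fin m}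
    (h : min k (τ k) = min k' (τ k')) : k' = k ∨ k' = τ k := by
  rcases min_choice k (τ k) with hk | hk <;> rcases min_choice k' (τ k') with hk' | hk' <;> rw [hk, hk'] at h
  · exact Or.inl h.symm
  · right; rw [← hττ k', ← h]
  · exact Or.inr h.symm
  · left
    have e := congrArg τ h
    rwa [hττ, hττ, eq_comm] at e

/-- Bilinear expansion `B(∑ αₐ xₐ, ∑ β_c y_c) = ∑∑ αₐ β_c B(xₐ, y_c)`. [folklore] -/
private theorem bilin_sum_smul_sum_smul'' {V : Type*} [AddCommGroup V] [Module ℂ V]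
    (B : LinearMap.BilinForm ℂ V) {n : ℕ} (α β : Fin n → ℂ) (x y : Fin n → V) :
    B (∑ a, α a • x a) (∑ c, β c • y c) = ∑ a, ∑ c, α a * β c * B (x a) (y c) := by
  simp only [map_sum, map_smul, LinearMap.sum_apply, LinearMap.smul_apply, smul_eq_mul, Finset.mul_sum]
  rw [Finset.sum_comm]
  refine Finset.sum_congr rfl fun a _ => Finset.sum_congr rfl fun c _ => ?_
  ring

/-- **The orthogonality hypothesis `hQπ` from an adjoint pair**: if `Q_h(ψ^*x, y) = Q_h(x, ψ'^*y)` (`ψ'` the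
Rosati conjugate of `ψ`), `v` is a `μ`-eigenvector of `ψ^*` and `w` a `ρ`-eigenvector of `ψ'^*` with `ρ ≠ μ`,
then `Q_h(v, w) = 0` (`μ Q(v,w) = ρ Q(v,w)`). For types II/III, `ψ ∈ L = F[α]` and `ψ' = ψ† ∈ L`: the
eigenspace `V_{σ₁}` of `ψ^*` pairs only with `V_{σ₂}`. [cite: Milne1999LefschetzClasses, §1 p. 642 (`e_D(βx, y) = e_D(x, β†y)`), §2 p. 650] -/
theorem polarizationPairingOne_eq_zero_of_mem_eigenspace_of_adjoint (ψ ψ' : A ⟶ A) {h : complexBetti A.X 2}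
    {n : ℕ} (hadj : ∀ x y : complexBetti A.X 1,
      polarizationPairingOne A.X h n (pullbackOne A ψ x) y = polarizationPairingOne A.X h n x (pullbackOne A ψ' y))
    {μ ρ : ℂ} {v w : complexBetti A.X 1} (hv : v ∈ Module.End.eigenspace (pullbackOne A ψ) μ)
    (hw : w ∈ Module.End.eigenspace (pullbackOne A ψ') ρ) (hne : ρ ≠ μ) :
    polarizationPairingOne A.X h n v w = 0 := by
  rw [Module.End.mem_eigenspace_iff] at hv hw
  have h1 : μ • polarizationPairingOne A.X h n v w = ρ • polarizationPairingOne A.X h n v w := by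
    rw [← LinearMap.smul_apply, ← map_smul, ← hv, hadj, hw, map_smul]
  have h2 : (μ - ρ) • polarizationPairingOne A.X h n v w = 0 := by rw [sub_smul, h1, sub_self]
  exact (smul_eq_zero.1 h2).resolve_left (sub_ne_zero.2 (Ne.symm hne))

/-- **Milne 1999, Prop. 3.6 (a), (b) with multiplicity and several blocks, `S(ℂ)`-form, for the powers of a
complex abelian variety with quaternionic multiplication in the CM presentation** (§2 pp. 649–650, types II
and III: "`V_σ = V_{σ₁} ⊕ V_{σ₂}` […] standard representation [on `V_{σ₁}`] […] contragredient [on `V_{σ₂}`]").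
Let `ψ, κ ∈ End(A)` with `C(A) ⊗ ℂ` the commutant of `{ψ^*, κ^*}`, `ψ^*` diagonalizable with all eigenspaces
`V_μ` of the same dimension, the polarization form of `h` pairing `V_μ` only with `V_{π(μ)}` (`π(μ) ≠ μ`),
`κ^*` `ε`-symmetric (`Q_h(κ^*x, y) = ε Q_h(x, κ^*y)`, `ε = ±1`) with `κ^* V_μ ⊆ V_{π(μ)}` and `κ^*κ^*` a non-zero
scalar on each `V_μ`. Then for every `N` every class of `H^{2p}(A^{N+1}(ℂ); ℂ)` fixed by `⋀^{2p}u` for all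
`u ∈ S(A^{N+1})(ℂ) = unitaryCentralizerGroup (A.powSucc N) (Σᵢ prᵢ^* h)` lies in `Dᵖ(A^{N+1}) ⊗ ℂ`
("`(⋀^*(⊕ rH_σ))^{∏S_σ} = ⊗_σ (⋀^* rH_σ)^{S_σ}` […] each […] generated by tensors of degree 2", `r = 2(N + 1)`,
`S_σ = O(φ_{2,σ₁})` for `ε = −1`, `Sp(φ_{2,σ₁})` for `ε = 1`). Proof: the several-blocks criterion
`mem_divisorClassesSpan_of_forall_exteriorPullback_eq_of_formBlocks` on the letters `prⱼ^* b(ℓ, k)` of the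
transported eigenbasis of §1 (colour of `(j, k)` = `{k, τ k}`, form `Θ_k = (λQ_h(b(ℓ,k), b(ℓ',τk)))`, symmetric
or alternating), the elements of `S(A)(ℂ)` acting by `g ∈ G(Θ_k)` on `V_k ⊕ V_{τ k}` and their diagonal images
in `S(A^{N+1})(ℂ)`, `θ_k = ∑ (Θ_k⁻¹)_{ac} b(a,k) ⌣ b(c,τk) ∈ B¹(A) ⊗ ℂ` by Prop. 3.3 (`S(ℂ)`-form), and the
crossed classes through the separation lemma (the eigenvalues `μ_k ≠ μ_{τk}` of `ψ^*`).
[cite: Milne1999LefschetzClasses, §1 p. 643, §2 pp. 649–650, Props. 3.3–3.4, 3.6 (a), (b), p. 656, Cor. 4.5 (p. 659)]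
[cite: GoodmanWallachGTM255, Thm. 5.3.3 (1), (2), Thm. 5.3.5] -/
theorem mem_divisorClassesSpan_powSucc_of_forall_exteriorPullback_eq_of_quaternionDual
    (ψ κ : A ⟶ A) (hC : centralizerAlgebra A = Subalgebra.centralizer ℂ {pullbackOne A ψ, pullbackOne A κ})
    (hdiag : ⨆ μ : ℂ, Module.End.eigenspace (pullbackOne A ψ) μ = ⊤) (N₁ : ℕ)
    (hn : ∀ μ : ℂ, Module.End.HasEigenvalue (pullbackOne A ψ) μ →
      Module.finrank ℂ (Module.End.eigenspace (pullbackOne A ψ) μ) = N₁)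
    {h : complexBetti A.X 2} (hQ : IsRationalClass h)
    (hK : ∃ s : ℝ, 0 < s ∧ IsKaehlerClass A.dim A.X ((s : ℂ) • h))
    (π : ℂ → ℂ) (hπ : ∀ μ : ℂ, Module.End.HasEigenvalue (pullbackOne A ψ) μ → π μ ≠ μ)
    (hQπ : ∀ (μ μ' : ℂ) (v w : complexBetti A.X 1), v ∈ Module.End.eigenspace (pullbackOne A ψ) μ →
      w ∈ Module.End.eigenspace (pullbackOne A ψ) μ' → μ' ≠ π μ →
      polarizationPairingOne A.X h (A.dim - 1) v w = 0)
    {ε : ℂ} (hε : ε = 1 ∨ ε = -1)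
    (hκQ : ∀ x y : complexBetti A.X 1,
      polarizationPairingOne A.X h (A.dim - 1) (pullbackOne A κ x) y =
        ε • polarizationPairingOne A.X h (A.dim - 1) x (pullbackOne A κ y))
    (hlink : ∀ (μ : ℂ) (v : complexBetti A.X 1), v ∈ Module.End.eigenspace (pullbackOne A ψ) μ →
      pullbackOne A κ v ∈ Module.End.eigenspace (pullbackOne A ψ) (π μ))
    (hκ2 : ∀ μ : ℂ, ∃ c : ℂ, c ≠ 0 ∧ ∀ v ∈ Module.End.eigenspace (pullbackOne A ψ) μ,
      pullbackOne A κ (pullbackOne A κ v) = c • v)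
    (N p : ℕ) (x : complexBetti (A.powSucc N).X (2 * p))
    (hx : ∀ u ∈ unitaryCentralizerGroup (A.powSucc N) (powPolarizationClass A h N),
      exteriorPullback (AbelianVariety.hasExteriorCohomologyH1_complexPoints (A.powSucc N))
        (u : complexBetti (A.powSucc N).X 1 →ₗ[ℂ] complexBetti (A.powSucc N).X 1) (2 * p) x = x) :
    x ∈ divisorClassesSpan (A.powSucc N).X (A.powSucc N).dim p := by
  classical
  haveI : Module.Finite ℂ (complexBetti A.X 1) := abelianVarietyCohomologyExteriorH1_holds.finite_one A
  haveI : Module.Finite ℂ (complexBetti (A.powSucc N).X 1) :=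
    abelianVarietyCohomologyExteriorH1_holds.finite_one (A.powSucc N)
  have hX := AbelianVariety.hasExteriorCohomologyH1_complexPoints (A.powSucc N)
  have hXA := AbelianVariety.hasExteriorCohomologyH1_complexPoints A
  -- degree `0`: everything is a multiple of the unit class
  rcases Nat.eq_zero_or_pos p with rfl | hp1
  · have htop : Submodule.span ℂ (Set.range (cupPowOne ℂ (ComplexPoints (A.powSucc N).X) 0)) = ⊤ :=
      hX.span_range_cupPowOne 0
    have hrange : Set.range (cupPowOne ℂ (ComplexPoints (A.powSucc N).X) 0) =
        {singularCohomology.one ℂ (ComplexPoints (A.powSucc N).X)} := by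
      ext c
      simp only [Set.mem_range, cupPowOne_zero, Set.mem_singleton_iff]
      exact ⟨fun ⟨_, e⟩ => e.symm, fun e => ⟨fun i => Fin.elim0 i, e.symm⟩⟩
    have hx' : x ∈ Submodule.span ℂ (Set.range (cupPowOne ℂ (ComplexPoints (A.powSucc N).X) 0)) := by
      rw [htop]; exact Submodule.mem_top
    rw [hrange] at hx'
    refine Submodule.span_mono (fun c hc => ?_) hx'
    rw [Set.mem_singleton_iff] at hc
    exact mem_divisorMonomials_zero.2 hc
  -- dimension `0`: no classes in positive degree
  rcases Nat.eq_zero_or_pos A.dim with hA | hA0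
  · haveI : Subsingleton (complexBetti (A.powSucc N).X (2 * p)) :=
      hX.subsingleton_of_lt (by rw [AbelianVariety.finrank_complexBetti_one, dim_powSucc_eq_succ_mul, hA]; omega)
    rw [Subsingleton.elim x 0]
    exact Submodule.zero_mem _
  -- the polarization data of `A`
  obtain ⟨s, hs, hKs⟩ := hK
  have hnd := eq_zero_of_forall_polarizationPairingOne_eq_zero_of_isKaehlerClass_smul' hs.ne' hKs
  have hh : h ∈ hodgeClassSpan A.dim A.X 1 := mem_hodgeClassSpan_one_of_isKaehlerClass_smul hQ hs.ne' hKs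
  obtain ⟨Bf, hBalt, hBnd, lam, hlam, hBapp⟩ := exists_bilinForm_isAlt_nondegenerate (A := A) hnd
  set J : Module.End ℂ (complexBetti A.X 1) := pullbackOne A ψ with hJ_def
  set Kκ : Module.End ℂ (complexBetti A.X 1) := pullbackOne A κ with hK_def
  have hKB : ∀ x y, Bf (Kκ x) y = ε * Bf x (Kκ y) := fun x y => by
    rw [hBapp, hBapp, hK_def, hκQ, map_smul, smul_eq_mul]
  have hBsep : ∀ z : complexBetti A.X 1, (∀ y, Bf z y = 0) → z = 0 := fun z hz =>
    hnd z fun y => hlam (by rw [← hBapp, hz y, map_zero])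
  have hεε : ε * ε = 1 := by rcases hε with rfl | rfl <;> norm_num
  have hV : 0 < Module.finrank ℂ (complexBetti A.X 1) := by
    rw [AbelianVariety.finrank_complexBetti_one]; omega
  -- the transported eigenbasis with linked pairs of blocks of size `N₁`
  obtain ⟨m, μ, τ, b₁, c, hμ, hττ, hτne, hπμ, hJb, hc0, hKb⟩ :=
    exists_linkedPairBlockBasis J Kκ hdiag hV hn π hπ hlink hκ2
  have hmemb : ∀ ℓ k, b₁ (ℓ, k) ∈ Module.End.eigenspace J (μ k) := fun ℓ k =>
    Module.End.mem_eigenspace_iff.2 (hJb ℓ k)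
  -- `Q_h(V_k, V_{k'}) = 0` unless `k' = τ k`
  have hcr : ∀ ℓ ℓ' k k', k' ≠ τ k → Bf (b₁ (ℓ, k)) (b₁ (ℓ', k')) = 0 := by
    intro ℓ ℓ' k k' hk'
    have hne : μ k' ≠ π (μ k) := by
      rw [hπμ]
      exact fun e => hk' (hμ e)
    rw [hBapp, hQπ (μ k) (μ k') _ _ (hmemb ℓ k) (hmemb ℓ' k') hne, map_zero]
  -- the transported letters
  have hbτ : ∀ ℓ k, b₁ (ℓ, τ k) = (c k)⁻¹ • Kκ (b₁ (ℓ, k)) := fun ℓ k => by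
    rw [hKb, smul_smul, inv_mul_cancel₀ (hc0 k), one_smul]
  -- the duality matrices `Θ_k` of `V_k × V_{τ k}`
  let Θ : Fin m → Matrix (Fin N₁) (Fin N₁) ℂ := fun k => Matrix.of fun ℓ ℓ' => Bf (b₁ (ℓ, k)) (b₁ (ℓ', τ k))
  have hΘ : ∀ k ℓ ℓ', Θ k ℓ ℓ' = Bf (b₁ (ℓ, k)) (b₁ (ℓ', τ k)) := fun _ _ _ => rfl
  -- `Θ_kᵀ = -ε Θ_k`: symmetric for `ε = -1`, alternating for `ε = 1`
  have hΘt : ∀ k ℓ ℓ', Θ k ℓ' ℓ = -ε * Θ k ℓ ℓ' := by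
    intro k ℓ ℓ'
    rw [hΘ, hΘ, hbτ ℓ k, hbτ ℓ' k, map_smul, map_smul, smul_eq_mul, smul_eq_mul,
      ← hBalt.neg_eq (Kκ (b₁ (ℓ, k))) (b₁ (ℓ', k)), hKB]
    ring
  have hΘτ : ∀ k, Θ (τ k) = ε • Θ k := by
    intro k
    ext ℓ ℓ'
    rw [Matrix.smul_apply, smul_eq_mul, hΘ, hττ, ← hBalt.neg_eq (b₁ (ℓ', k)) (b₁ (ℓ, τ k)), ← hΘ, hΘt]
    ring
  have hΘform : ∀ k, (Matrix.toBilin' (Θ k)).IsAlt ∨ (Matrix.toBilin' (Θ k)).IsSymm := by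
    intro k
    rcases hε with hε1 | hε1
    · left
      refine isAlt_toBilin'_of_forall_eq_neg fun a a' => ?_
      rw [hΘt, hε1]
      ring
    · right
      refine isSymm_toBilin'_of_forall_eq fun a a' => ?_
      rw [hΘt, hε1]
      ring
  -- the dualities are perfect
  have hdetk : ∀ k, (Θ k).det ≠ 0 := by
    intro k h0
    obtain ⟨w, hw0, hw⟩ := Matrix.exists_vecMul_eq_zero_iff.2 h0
    have hz0 : (∑ ℓ, w ℓ • b₁ (ℓ, k)) = 0 := by
      refine hBsep _ fun y => ?_
      suffices hbas : ∀ i, Bf (∑ ℓ, w ℓ • b₁ (ℓ, k)) (b₁ i) = 0 by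
        rw [← b₁.sum_repr y, map_sum]
        exact Finset.sum_eq_zero fun i _ => by rw [map_smul, hbas, smul_zero]
      rintro ⟨ℓ', k'⟩
      rw [map_sum, LinearMap.sum_apply]
      by_cases hk' : k' = τ k
      · subst hk'
        have e := congr_fun hw ℓ'
        change ∑ ℓ, w ℓ * Θ k ℓ ℓ' = 0 at e
        rw [← e]
        refine Finset.sum_congr rfl fun ℓ _ => ?_
        rw [map_smul, LinearMap.smul_apply, smul_eq_mul, hΘ]
      · refine Finset.sum_eq_zero fun ℓ _ => ?_
        rw [map_smul, LinearMap.smul_apply, hcr ℓ ℓ' k k' hk', smul_zero]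
    have hli : LinearIndependent ℂ fun ℓ : Fin N₁ => b₁ (ℓ, k) :=
      b₁.linearIndependent.comp (fun ℓ => (ℓ, k)) fun a a' e => (Prod.mk.inj e).1
    exact hw0 (funext fun ℓ => Fintype.linearIndependent_iff.1 hli w hz0 ℓ)
  have hΘn : ∀ k, (Matrix.toBilin' (Θ k)).Nondegenerate := fun k =>
    LinearMap.BilinForm.nondegenerate_toBilin'_iff_det_ne_zero.2 (hdetk k)
  -- `Θ` on a pair: `Θ_{min} = η Θ_k`, `η ∈ {1, ε}`
  have hΘmin : ∀ k, ∃ η : ℂ, η * η = 1 ∧ Θ (min k (τ k)) = η • Θ k := by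
    intro k
    rcases min_choice k (τ k) with e | e <;> rw [e]
    · exact ⟨1, one_mul 1, (one_smul _ _).symm⟩
    · exact ⟨ε, hεε, hΘτ k⟩
  -- membership in `S(A)(ℂ)`: commute with `J` and `Kκ` (hence with `End(A)`, by `hC`) and preserve `Bf`
  have hmem : ∀ u : complexBetti A.X 1 ≃ₗ[ℂ] complexBetti A.X 1,
      J * (u : Module.End ℂ (complexBetti A.X 1)) = (u : Module.End ℂ (complexBetti A.X 1)) * J →
      Kκ * (u : Module.End ℂ (complexBetti A.X 1)) = (u : Module.End ℂ (complexBetti A.X 1)) * Kκ →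
      (∀ a c', Bf (u a) (u c') = Bf a c') → u ∈ unitaryCentralizerGroup A h := by
    intro u hcommJ hcommK hu
    refine ⟨mem_centralizerGroup_iff_coe_mem.2 ?_, fun a c' => hlam (by rw [← hBapp, ← hBapp, hu a c'])⟩
    rw [hC, Subalgebra.mem_centralizer_iff]
    intro g hg
    rcases hg with rfl | hg
    · exact hcommJ
    · rw [Set.mem_singleton_iff] at hg
      rw [hg]
      exact hcommK
  -- conversely an element of `S(A)(ℂ)` commutes with `J`, `Kκ` and preserves `Bf`
  have hofmem : ∀ u ∈ unitaryCentralizerGroup A h,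
      (∀ v, J (u v) = u (J v)) ∧ (∀ v, Kκ (u v) = u (Kκ v)) ∧ ∀ a c', Bf (u a) (u c') = Bf a c' := by
    intro u hu
    have hc' := mem_centralizerGroup_iff_coe_mem.1 hu.1
    rw [hC, Subalgebra.mem_centralizer_iff] at hc'
    refine ⟨fun v => ?_, fun v => ?_, fun a c' => by rw [hBapp, hBapp, hu.2]⟩
    · exact LinearMap.congr_fun (hc' J (Set.mem_insert J _)) v
    · exact LinearMap.congr_fun (hc' Kκ (Set.mem_insert_of_mem J rfl)) v
  -- `θ_k = ∑ (Θ_k⁻¹)_{ac} b(a,k) ⌣ b(c,τk) ∈ B¹(A) ⊗ ℂ`: fixed by every `u ∈ S(A)(ℂ)` (Prop. 3.3, `S(ℂ)`-form)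
  have hθ : ∀ k, (∑ a, ∑ c', (Θ k)⁻¹ a c' • cupProduct (rfl : 1 + 1 = 2) (b₁ (a, k)) (b₁ (c', τ k))) ∈
      Submodule.span ℂ {c : complexBetti A.X 2 | IsRationalClass c ∧ IsOfHodgeType A.dim A.X 2 1 1 c} := by
    intro k
    have hΩunit : IsUnit (Θ k).det := isUnit_iff_ne_zero.2 (hdetk k)
    refine mem_hodgeClassSpan_of_forall_exteriorPullback_eq hh (p := 1) fun u hu => ?_
    obtain ⟨huJ, huK, huB⟩ := hofmem u hu
    set Mk : Matrix (Fin N₁) (Fin N₁) ℂ := Matrix.of fun ℓ' ℓ => b₁.repr (u (b₁ (ℓ, k))) (ℓ', k) with hMk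
    have huM₀ : ∀ ℓ, u (b₁ (ℓ, k)) = ∑ ℓ', Mk ℓ' ℓ • b₁ (ℓ', k) := fun ℓ =>
      apply_basis_eq_sum_block b₁ J hμ hJb (u := ⇑u) huJ (fun c v => map_smul u c v) ℓ k
    have huMτ₀ : ∀ ℓ, u (b₁ (ℓ, τ k)) = ∑ ℓ', Mk ℓ' ℓ • b₁ (ℓ', τ k) := fun ℓ => by
      rw [hbτ ℓ k, map_smul, ← huK, huM₀ ℓ, map_sum, Finset.smul_sum]
      refine Finset.sum_congr rfl fun ℓ' _ => ?_
      rw [map_smul, hKb, smul_smul, smul_smul, mul_assoc, mul_comm (Mk ℓ' ℓ) (c k), ← mul_assoc,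
        inv_mul_cancel₀ (hc0 k), one_mul]
    have huM : ∀ ℓ, (u : complexBetti A.X 1 →ₗ[ℂ] complexBetti A.X 1) (b₁ (ℓ, k)) =
        ∑ ℓ', Mk ℓ' ℓ • b₁ (ℓ', k) := fun ℓ => by
      rw [LinearEquiv.coe_coe]
      exact huM₀ ℓ
    have huMτ : ∀ ℓ, (u : complexBetti A.X 1 →ₗ[ℂ] complexBetti A.X 1) (b₁ (ℓ, τ k)) =
        ∑ ℓ', Mk ℓ' ℓ • b₁ (ℓ', τ k) := fun ℓ => by
      rw [LinearEquiv.coe_coe]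
      exact huMτ₀ ℓ
    have hMΘ : Mkᵀ * Θ k * Mk = Θ k := by
      ext ℓ ℓ'
      have e := bilin_apply_family₂_eq_transpose_mul_mul Bf (fun a => b₁ (a, k)) (fun a => b₁ (a, τ k))
        (u := ⇑(u : complexBetti A.X 1 →ₗ[ℂ] complexBetti A.X 1)) (M := Mk) (M' := Mk) huM huMτ ℓ ℓ'
      rw [LinearEquiv.coe_coe, huB] at e
      rw [← e]
      rfl
    have hinv : Mk * (Θ k)⁻¹ * Mkᵀ = (Θ k)⁻¹ := mul_inv_mul_transpose_eq hΩunit hMΘ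
    change exteriorPullback hXA (u : complexBetti A.X 1 →ₗ[ℂ] complexBetti A.X 1) 2
      (∑ a, ∑ c', (Θ k)⁻¹ a c' • cupProduct (rfl : 1 + 1 = 2) (b₁ (a, k)) (b₁ (c', τ k))) = _
    rw [map_sum]
    simp_rw [map_sum, map_smul, exteriorPullback_cupProduct_one_one]
    have key := sum_sum_smul_bilin_eq₂ (cupProduct (rfl : 1 + 1 = 2)) (fun a => b₁ (a, k))
      (fun a => b₁ (a, τ k)) (u := ⇑(u : complexBetti A.X 1 →ₗ[ℂ] complexBetti A.X 1)) huM huMτ (Θ k)⁻¹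
    rw [key, hinv]
  -- the letters of `H¹(A^{N+1})`: `prⱼ^* b(ℓ, k)`, slots `(j, k)`, colour `min k (τ k)`
  let y : (Fin (N + 1) × Fin m) × Fin N₁ → complexBetti (A.powSucc N).X 1 := fun sl =>
    complexBetti.map (powSlots A N sl.1.1).hom.hom.hom 1 (b₁ (sl.2, sl.1.2))
  have hy : ∀ j k ℓ, y ((j, k), ℓ) = complexBetti.map (powSlots A N j).hom.hom.hom 1 (b₁ (ℓ, k)) :=
    fun _ _ _ => rfl
  have hyspan : ⊤ ≤ Submodule.span ℂ (Set.range y) := by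
    intro z _
    have hz := mem_span_map_powSlots A N z
    refine (Submodule.span_le.2 ?_) hz
    rintro _ ⟨⟨j, v⟩, rfl⟩
    change complexBetti.map (powSlots A N j).hom.hom.hom 1 v ∈ Submodule.span ℂ (Set.range y)
    rw [← b₁.sum_repr v, map_sum]
    refine Submodule.sum_mem _ fun a _ => ?_
    rw [map_smul]
    obtain ⟨ℓ, k⟩ := a
    exact Submodule.smul_mem _ _ (Submodule.subset_span ⟨((j, k), ℓ), rfl⟩)
  have h2dim : 2 * A.dim = N₁ * m := by
    rw [← AbelianVariety.finrank_complexBetti_one, Module.finrank_eq_card_basis b₁, Fintype.card_prod,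
      Fintype.card_fin, Fintype.card_fin]
  have hcard : Fintype.card ((Fin (N + 1) × Fin m) × Fin N₁) =
      Module.finrank ℂ (complexBetti (A.powSucc N).X 1) := by
    rw [AbelianVariety.finrank_complexBetti_one, dim_powSucc_eq_succ_mul,
      show 2 * ((N + 1) * A.dim) = (N + 1) * (2 * A.dim) by ring, h2dim]
    simp only [Fintype.card_prod, Fintype.card_fin]
    ring
  obtain ⟨bB, hbB⟩ : ∃ bB : Module.Basis ((Fin (N + 1) × Fin m) × Fin N₁) ℂ (complexBetti (A.powSucc N).X 1),
      ∀ sl, bB sl = y sl :=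
    ⟨basisOfTopLeSpanOfCardEqFinrank y hyspan hcard, fun sl => by rw [coe_basisOfTopLeSpanOfCardEqFinrank]⟩
  let col : Fin (N + 1) × Fin m → Fin m := fun t => min t.2 (τ t.2)
  -- THE CRITERION: the form groups of the linked pairs acting diagonally on the slots
  refine mem_divisorClassesSpan_of_forall_exteriorPullback_eq_of_formBlocks bB col Θ hΘform hΘn
    (unitaryCentralizerGroup (A.powSucc N) (powPolarizationClass A h N))
    (fun k₀ g hg => ?_) (fun t t' htt' => ?_) p x hx
  · -- the element acting by `g` on the blocks `k` with `{k, τ k} ∋ k₀ = min`, and its diagonal image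
    have hgdet : IsUnit g.det := by
      have hdet := congrArg Matrix.det hg
      rw [Matrix.det_mul, Matrix.det_mul, Matrix.det_transpose] at hdet
      have hsq : g.det * g.det = 1 := by
        have h1 : g.det * g.det * (Θ k₀).det = 1 * (Θ k₀).det := by
          rw [one_mul]
          calc g.det * g.det * (Θ k₀).det = g.det * (Θ k₀).det * g.det := by ring
            _ = (Θ k₀).det := hdet
        exact mul_right_cancel₀ (hdetk k₀) h1
      exact IsUnit.of_mul_eq_one _ hsq
    let d : Fin m → Matrix (Fin N₁) (Fin N₁) ℂ := fun k => if min k (τ k) = k₀ then g else 1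
    have hdτ : ∀ k, d (τ k) = d k := fun k => by
      simp only [d, hττ, min_comm (τ k) k]
    have hd : ∀ k, (d k)ᵀ * Θ k * d k = Θ k := fun k => by
      by_cases hk : min k (τ k) = k₀
      · simp only [d, if_pos hk]
        obtain ⟨η, hηη, hη⟩ := hΘmin k
        rw [hk] at hη
        have hΘk : Θ k = η • Θ k₀ := by rw [hη, smul_smul, hηη, one_smul]
        rw [hΘk, Matrix.mul_smul, Matrix.smul_mul, hg]
      · simp only [d, if_neg hk, Matrix.transpose_one, Matrix.one_mul, Matrix.mul_one]
    have hddet : ∀ k, (d k).det ≠ 0 := fun k => by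
      by_cases hk : min k (τ k) = k₀
      · simp only [d, if_pos hk]
        exact hgdet.ne_zero
      · simp only [d, if_neg hk, Matrix.det_one]
        exact one_ne_zero
    let M : Matrix (Fin N₁ × Fin m) (Fin N₁ × Fin m) ℂ := Matrix.blockDiagonal d
    have hMdet : IsUnit M.det := by
      refine isUnit_iff_ne_zero.2 ?_
      change (Matrix.blockDiagonal d).det ≠ 0
      rw [Matrix.det_blockDiagonal]
      exact Finset.prod_ne_zero_iff.2 fun k _ => hddet k
    let f : complexBetti A.X 1 →ₗ[ℂ] complexBetti A.X 1 := Matrix.toLin b₁ b₁ M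
    have hfdet : IsUnit (LinearMap.toMatrix b₁ b₁ f).det := by
      change IsUnit (LinearMap.toMatrix b₁ b₁ (Matrix.toLin b₁ b₁ M)).det
      rw [LinearMap.toMatrix_toLin]
      exact hMdet
    let u₁ : complexBetti A.X 1 ≃ₗ[ℂ] complexBetti A.X 1 := LinearEquiv.ofIsUnitDet hfdet
    have hu₁ : ∀ ℓ k, u₁ (b₁ (ℓ, k)) = ∑ ℓ', d k ℓ' ℓ • b₁ (ℓ', k) := fun ℓ k => by
      change f (b₁ (ℓ, k)) = _
      change Matrix.toLin b₁ b₁ M (b₁ (ℓ, k)) = _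
      rw [Matrix.toLin_self, Fintype.sum_prod_type]
      refine Finset.sum_congr rfl fun ℓ' _ => ?_
      rw [Finset.sum_eq_single k]
      · change Matrix.blockDiagonal d (ℓ', k) (ℓ, k) • b₁ (ℓ', k) = _
        rw [Matrix.blockDiagonal_apply_eq]
      · intro k' _ hk'
        change Matrix.blockDiagonal d (ℓ', k') (ℓ, k) • b₁ (ℓ', k') = 0
        rw [Matrix.blockDiagonal_apply_ne d ℓ' ℓ hk', zero_smul]
      · intro hk
        exact absurd (Finset.mem_univ k) hk
    have hu₁B : ∀ a c', Bf (u₁ a) (u₁ c') = Bf a c' := by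
      have H : Bf.comp (u₁ : complexBetti A.X 1 →ₗ[ℂ] complexBetti A.X 1)
          (u₁ : complexBetti A.X 1 →ₗ[ℂ] complexBetti A.X 1) = Bf := by
        refine LinearMap.BilinForm.ext_basis b₁ fun i j => ?_
        obtain ⟨ℓ, k⟩ := i
        obtain ⟨ℓ', k'⟩ := j
        rw [LinearMap.BilinForm.comp_apply, LinearEquiv.coe_coe]
        by_cases hkk' : k' = τ k
        · subst hkk'
          rw [bilin_apply_family₂_eq_transpose_mul_mul Bf (fun a => b₁ (a, k)) (fun a => b₁ (a, τ k)) (u := ⇑u₁)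
            (M := d k) (M' := d (τ k)) (fun i => hu₁ i k) (fun i => hu₁ i (τ k)) ℓ ℓ', hdτ]
          change ((d k)ᵀ * Θ k * d k) ℓ ℓ' = _
          rw [hd k, hΘ]
        · rw [hu₁, hu₁, bilin_sum_smul_sum_smul'', hcr ℓ ℓ' k k' hkk']
          refine Finset.sum_eq_zero fun a _ => Finset.sum_eq_zero fun c' _ => ?_
          rw [hcr a c' k k' hkk', mul_zero]
      intro a c'
      have e := congrArg (fun B' : LinearMap.BilinForm ℂ (complexBetti A.X 1) => B' a c') H
      simp only [LinearMap.BilinForm.comp_apply, LinearEquiv.coe_coe] at e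
      exact e
    have hu₁J : J * (u₁ : Module.End ℂ (complexBetti A.X 1)) = (u₁ : Module.End ℂ (complexBetti A.X 1)) * J := by
      refine b₁.ext fun i => ?_
      obtain ⟨ℓ, k⟩ := i
      rw [Module.End.mul_apply, Module.End.mul_apply, LinearEquiv.coe_coe, hJb, map_smul, hu₁, map_sum,
        Finset.smul_sum]
      refine Finset.sum_congr rfl fun ℓ' _ => ?_
      rw [map_smul, hJb, smul_comm]
    have hu₁K : Kκ * (u₁ : Module.End ℂ (complexBetti A.X 1)) =
        (u₁ : Module.End ℂ (complexBetti A.X 1)) * Kκ := by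
      refine b₁.ext fun i => ?_
      obtain ⟨ℓ, k⟩ := i
      rw [Module.End.mul_apply, Module.End.mul_apply, LinearEquiv.coe_coe, hKb, map_smul, hu₁, map_sum,
        hu₁, Finset.smul_sum, hdτ]
      refine Finset.sum_congr rfl fun ℓ' _ => ?_
      rw [map_smul, hKb, smul_comm]
    have hu₁S : u₁ ∈ unitaryCentralizerGroup A h := hmem u₁ hu₁J hu₁K hu₁B
    refine ⟨diagPow A u₁ N, diagPow_mem_unitaryCentralizerGroup hA0 hu₁S N, fun t ℓ => ?_⟩
    obtain ⟨j, k⟩ := t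
    rw [hbB, hy, diagPow_intertwine_right hu₁S.1, hu₁, map_sum]
    refine Finset.sum_congr rfl fun ℓ' _ => ?_
    rw [map_smul, hbB, hy]
  · -- the crossed classes of two slots of one colour are divisor classes
    obtain ⟨j, k⟩ := t
    obtain ⟨j', k'⟩ := t'
    change min k (τ k) = min k' (τ k') at htt'
    simp_rw [hbB]
    change (∑ a, ∑ c', (Θ (min k (τ k)))⁻¹ a c' • cupProduct (rfl : 1 + 1 = 2)
      (complexBetti.map (powSlots A N j).hom.hom.hom 1 (b₁ (a, k)))
      (complexBetti.map (powSlots A N j').hom.hom.hom 1 (b₁ (c', k')))) ∈ _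
    obtain ⟨η, hηη, hη⟩ := hΘmin k
    have hΩunit : IsUnit (Θ k).det := isUnit_iff_ne_zero.2 (hdetk k)
    have hinvη : (Θ (min k (τ k)))⁻¹ = η • (Θ k)⁻¹ := by
      rw [hη]
      refine Matrix.inv_eq_left_inv ?_
      rw [Matrix.smul_mul, Matrix.mul_smul, smul_smul, hηη, one_smul, Matrix.nonsing_inv_mul _ hΩunit]
    simp_rw [hinvη, Matrix.smul_apply, smul_eq_mul, mul_smul, ← Finset.smul_sum]
    refine Submodule.smul_mem _ _ ?_
    -- `ψ^*` separates the two families of letters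
    have he : ∀ a, complexBetti.map ψ.hom.hom.hom 1 (b₁ (a, k)) = μ k • b₁ (a, k) := fun a => hJb a k
    have he' : ∀ a, complexBetti.map ψ.hom.hom.hom 1 (b₁ (a, τ k)) = μ (τ k) • b₁ (a, τ k) :=
      fun a => hJb a (τ k)
    have hμne : μ k ≠ μ (τ k) := fun e => hτne k (hμ e).symm
    rcases eq_or_eq_of_min_eq' hττ htt' with hk' | hk' <;> subst k'
    · -- the same block on two slots: its letters are `κ^*`-translates of those of the linked block
      have hb' : ∀ c', b₁ (c', k) = (c (τ k))⁻¹ • Kκ (b₁ (c', τ k)) := fun c' => by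
        have e := hbτ c' (τ k)
        rwa [hττ] at e
      have hrw : ∀ a c', cupProduct (rfl : 1 + 1 = 2)
          (complexBetti.map (powSlots A N j).hom.hom.hom 1 (b₁ (a, k)))
          (complexBetti.map (powSlots A N j').hom.hom.hom 1 (b₁ (c', k))) =
          (c (τ k))⁻¹ • cupProduct (rfl : 1 + 1 = 2)
            (complexBetti.map (powSlots A N j).hom.hom.hom 1 (b₁ (a, k)))
            (complexBetti.map (powSlots A N j' ≫ κ).hom.hom.hom 1 (b₁ (c', τ k))) := by
        intro a c'
        rw [hb' c', map_smul, map_smul, complexBetti_map_comp_apply]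
      simp_rw [hrw, smul_comm _ (c (τ k))⁻¹, ← Finset.smul_sum]
      exact Submodule.smul_mem _ _ (sum_smul_cross₂_mem_span_rational_oneOne (powSlots A N j)
        (powSlots A N j' ≫ κ) ψ (fun a => b₁ (a, k)) (fun a => b₁ (a, τ k)) hμne he he' (Θ k)⁻¹ (hθ k))
    · -- the linked block: the maps are `prⱼ` and `pr_{j'}`
      exact sum_smul_cross₂_mem_span_rational_oneOne (powSlots A N j) (powSlots A N j') ψ
        (fun a => b₁ (a, k)) (fun a => b₁ (a, τ k)) hμne he he' (Θ k)⁻¹ (hθ k)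

/-- **The polarization package of every power `A^{N+1}` of an abelian variety with quaternionic
multiplication in the CM presentation** (`0 < dim A`): Milne's class `Σᵢ prᵢ^* h ∈ B¹(A^{N+1}) ⊗ ℂ` with
`(Σᵢ prᵢ^* h)^{dim} ≠ 0`, `Q` non-degenerate (`SpecialLefschetzGroupOneEqUnitaryCentralizer` §Powers) and the `S(ℂ)`-form above — the
datum consumed by `SpecialLefschetzGroupInvariantsFiniteProducts` (packages of factors ⇒ packages of finite
`Hom`-orthogonal products). [cite: Milne1999LefschetzClasses, §1 p. 643, Prop. 3.4, Cor. 4.5 (p. 659)] -/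
theorem exists_polarization_invariants_le_powSucc_of_quaternionDual (ψ κ : A ⟶ A)
    (hC : centralizerAlgebra A = Subalgebra.centralizer ℂ {pullbackOne A ψ, pullbackOne A κ})
    (hdiag : ⨆ μ : ℂ, Module.End.eigenspace (pullbackOne A ψ) μ = ⊤) (N₁ : ℕ)
    (hn : ∀ μ : ℂ, Module.End.HasEigenvalue (pullbackOne A ψ) μ →
      Module.finrank ℂ (Module.End.eigenspace (pullbackOne A ψ) μ) = N₁)
    {h : complexBetti A.X 2} (hQ : IsRationalClass h)
    (hK : ∃ s : ℝ, 0 < s ∧ IsKaehlerClass A.dim A.X ((s : ℂ) • h))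
    (π : ℂ → ℂ) (hπ : ∀ μ : ℂ, Module.End.HasEigenvalue (pullbackOne A ψ) μ → π μ ≠ μ)
    (hQπ : ∀ (μ μ' : ℂ) (v w : complexBetti A.X 1), v ∈ Module.End.eigenspace (pullbackOne A ψ) μ →
      w ∈ Module.End.eigenspace (pullbackOne A ψ) μ' → μ' ≠ π μ →
      polarizationPairingOne A.X h (A.dim - 1) v w = 0)
    {ε : ℂ} (hε : ε = 1 ∨ ε = -1)
    (hκQ : ∀ x y : complexBetti A.X 1,
      polarizationPairingOne A.X h (A.dim - 1) (pullbackOne A κ x) y =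
        ε • polarizationPairingOne A.X h (A.dim - 1) x (pullbackOne A κ y))
    (hlink : ∀ (μ : ℂ) (v : complexBetti A.X 1), v ∈ Module.End.eigenspace (pullbackOne A ψ) μ →
      pullbackOne A κ v ∈ Module.End.eigenspace (pullbackOne A ψ) (π μ))
    (hκ2 : ∀ μ : ℂ, ∃ c : ℂ, c ≠ 0 ∧ ∀ v ∈ Module.End.eigenspace (pullbackOne A ψ) μ,
      pullbackOne A κ (pullbackOne A κ v) = c • v)
    (hA0 : 0 < A.dim) (N : ℕ) :
    ∃ D : complexBetti (A.powSucc N).X 2, D ∈ hodgeClassSpan (A.powSucc N).dim (A.powSucc N).X 1 ∧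
      lefschetzPow D ((A.powSucc N).dim - 1) 2 D ≠ 0 ∧
      (∀ z : complexBetti (A.powSucc N).X 1,
        (∀ y, polarizationPairingOne (A.powSucc N).X D ((A.powSucc N).dim - 1) z y = 0) → z = 0) ∧
      ∀ (a : ℕ) (y : complexBetti (A.powSucc N).X (2 * a)), (∀ u ∈ unitaryCentralizerGroup (A.powSucc N) D,
        exteriorPullback (AbelianVariety.hasExteriorCohomologyH1_complexPoints (A.powSucc N))
          (u : complexBetti (A.powSucc N).X 1 →ₗ[ℂ] complexBetti (A.powSucc N).X 1) (2 * a) y = y) →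
        y ∈ divisorClassesSpan (A.powSucc N).X (A.powSucc N).dim a := by
  obtain ⟨s, hs, hKs⟩ := hK
  have hnd := eq_zero_of_forall_polarizationPairingOne_eq_zero_of_isKaehlerClass_smul' hs.ne' hKs
  have hh : h ∈ hodgeClassSpan A.dim A.X 1 := mem_hodgeClassSpan_one_of_isKaehlerClass_smul hQ hs.ne' hKs
  have htop : lefschetzPow h (A.dim - 1) 2 h ≠ 0 := lefschetzPow_self_ne_zero_of_isKaehlerClass_smul hA0 hKs
  exact ⟨powPolarizationClass A h N, powPolarizationClass_mem_hodgeClassSpan hh N,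
    lefschetzPow_powPolarizationClass_self_ne_zero hA0 htop N,
    eq_zero_of_forall_polarizationPairingOne_powPolarizationClass_eq_zero hA0 htop hnd N,
    fun a y hy => mem_divisorClassesSpan_powSucc_of_forall_exteriorPullback_eq_of_quaternionDual ψ κ hC hdiag N₁
      hn hQ ⟨s, hs, hKs⟩ π hπ hQπ hε hκQ hlink hκ2 N a y hy⟩

/-- **The conclusion of the record `Milne1999_specialLefschetzGroup_invariants_le` (Milne 1999, Cor. 4.5 with
Thm. 4.4, Thm. 3.2 and Prop. 3.6 (a), (b) WITH MULTIPLICITY, §2 types II and III in the CM presentation) PROVED for every power of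
an abelian variety with quaternionic multiplication whose polarization pairs the linked halves**: for `A` as above and every `N`, every class
`x ∈ H^{2p}(A^{N+1}(ℂ); ℂ)` fixed by every element of `specialLefschetzGroup (dim A^{N+1}) (A^{N+1}).X` lies
in `Dᵖ_hom(A^{N+1})_ℂ` (`A^{N+1} = A.powSucc N`; in dimension `0` there is nothing to prove).
[cite: Milne1999LefschetzClasses, §2 p. 649, Cor. 4.5 and Cor. 4.7 (p. 659), Thm. 3.2, Prop. 3.6 (a), p. 656]
[cite: GoodmanWallachGTM255, Thm. 5.3.3] -/
theorem specialLefschetzGroup_invariants_le_powSucc_of_quaternionDual (ψ κ : A ⟶ A)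
    (hC : centralizerAlgebra A = Subalgebra.centralizer ℂ {pullbackOne A ψ, pullbackOne A κ})
    (hdiag : ⨆ μ : ℂ, Module.End.eigenspace (pullbackOne A ψ) μ = ⊤) (N₁ : ℕ)
    (hn : ∀ μ : ℂ, Module.End.HasEigenvalue (pullbackOne A ψ) μ →
      Module.finrank ℂ (Module.End.eigenspace (pullbackOne A ψ) μ) = N₁)
    {h : complexBetti A.X 2} (hQ : IsRationalClass h)
    (hK : ∃ s : ℝ, 0 < s ∧ IsKaehlerClass A.dim A.X ((s : ℂ) • h))
    (π : ℂ → ℂ) (hπ : ∀ μ : ℂ, Module.End.HasEigenvalue (pullbackOne A ψ) μ → π μ ≠ μ)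
    (hQπ : ∀ (μ μ' : ℂ) (v w : complexBetti A.X 1), v ∈ Module.End.eigenspace (pullbackOne A ψ) μ →
      w ∈ Module.End.eigenspace (pullbackOne A ψ) μ' → μ' ≠ π μ →
      polarizationPairingOne A.X h (A.dim - 1) v w = 0)
    {ε : ℂ} (hε : ε = 1 ∨ ε = -1)
    (hκQ : ∀ x y : complexBetti A.X 1,
      polarizationPairingOne A.X h (A.dim - 1) (pullbackOne A κ x) y =
        ε • polarizationPairingOne A.X h (A.dim - 1) x (pullbackOne A κ y))
    (hlink : ∀ (μ : ℂ) (v : complexBetti A.X 1), v ∈ Module.End.eigenspace (pullbackOne A ψ) μ →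
      pullbackOne A κ v ∈ Module.End.eigenspace (pullbackOne A ψ) (π μ))
    (hκ2 : ∀ μ : ℂ, ∃ c : ℂ, c ≠ 0 ∧ ∀ v ∈ Module.End.eigenspace (pullbackOne A ψ) μ,
      pullbackOne A κ (pullbackOne A κ v) = c • v)
    (N p : ℕ) (x : complexBetti (A.powSucc N).X (2 * p))
    (hx : ∀ g ∈ specialLefschetzGroup (A.powSucc N).dim (A.powSucc N).X, g (2 * p) x = x) :
    x ∈ divisorClassesSpan (A.powSucc N).X (A.powSucc N).dim p := by
  classical
  have hX := AbelianVariety.hasExteriorCohomologyH1_complexPoints (A.powSucc N)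
  rcases Nat.eq_zero_or_pos A.dim with hA | hA0
  · -- dimension `0`: `H^{2p}(A^{N+1}) = 0` for `p ≥ 1`, `H⁰ = ℂ · 1`
    rcases Nat.eq_zero_or_pos p with rfl | hp1
    · have htop : Submodule.span ℂ (Set.range (cupPowOne ℂ (ComplexPoints (A.powSucc N).X) 0)) = ⊤ :=
        hX.span_range_cupPowOne 0
      have hrange : Set.range (cupPowOne ℂ (ComplexPoints (A.powSucc N).X) 0) =
          {singularCohomology.one ℂ (ComplexPoints (A.powSucc N).X)} := by
        ext c
        simp only [Set.mem_range, cupPowOne_zero, Set.mem_singleton_iff]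
        exact ⟨fun ⟨_, e⟩ => e.symm, fun e => ⟨fun i => Fin.elim0 i, e.symm⟩⟩
      have hx' : x ∈ Submodule.span ℂ (Set.range (cupPowOne ℂ (ComplexPoints (A.powSucc N).X) 0)) := by
        rw [htop]; exact Submodule.mem_top
      rw [hrange] at hx'
      refine Submodule.span_mono (fun c hc => ?_) hx'
      rw [Set.mem_singleton_iff] at hc
      exact mem_divisorMonomials_zero.2 hc
    · haveI : Module.Finite ℂ (complexBetti (A.powSucc N).X 1) :=
        abelianVarietyCohomologyExteriorH1_holds.finite_one (A.powSucc N)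
      haveI : Subsingleton (complexBetti (A.powSucc N).X (2 * p)) :=
        hX.subsingleton_of_lt (by rw [AbelianVariety.finrank_complexBetti_one, dim_powSucc_eq_succ_mul, hA]; omega)
      rw [Subsingleton.elim x 0]
      exact Submodule.zero_mem _
  · exact specialLefschetzGroup_invariants_le_of_exists_polarization_invariants_le (dim_powSucc_pos hA0 N)
      (exists_polarization_invariants_le_powSucc_of_quaternionDual ψ κ hC hdiag N₁ hn hQ hK π hπ hQπ hε hκQ hlink hκ2 hA0 N) p x hx

/-- **The record for every complex abelian variety ISOGENOUS to a power of an abelian variety with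
quaternionic multiplication in the CM presentation** ("`S(A)` depends only on the isogeny class of `A`", §1 p. 644; Cor. 4.7).
[cite: Milne1999LefschetzClasses, §1 p. 644, Prop. 1.5, Cor. 4.5 and Cor. 4.7 (p. 659)] -/
theorem specialLefschetzGroup_invariants_le_of_isIsogenous_powSucc_of_quaternionDual {X : AbelianVariety ℂ}
    (ψ κ : A ⟶ A)
    (hC : centralizerAlgebra A = Subalgebra.centralizer ℂ {pullbackOne A ψ, pullbackOne A κ})
    (hdiag : ⨆ μ : ℂ, Module.End.eigenspace (pullbackOne A ψ) μ = ⊤) (N₁ : ℕ)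
    (hn : ∀ μ : ℂ, Module.End.HasEigenvalue (pullbackOne A ψ) μ →
      Module.finrank ℂ (Module.End.eigenspace (pullbackOne A ψ) μ) = N₁)
    {h : complexBetti A.X 2} (hQ : IsRationalClass h)
    (hK : ∃ s : ℝ, 0 < s ∧ IsKaehlerClass A.dim A.X ((s : ℂ) • h))
    (π : ℂ → ℂ) (hπ : ∀ μ : ℂ, Module.End.HasEigenvalue (pullbackOne A ψ) μ → π μ ≠ μ)
    (hQπ : ∀ (μ μ' : ℂ) (v w : complexBetti A.X 1), v ∈ Module.End.eigenspace (pullbackOne A ψ) μ →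
      w ∈ Module.End.eigenspace (pullbackOne A ψ) μ' → μ' ≠ π μ →
      polarizationPairingOne A.X h (A.dim - 1) v w = 0)
    {ε : ℂ} (hε : ε = 1 ∨ ε = -1)
    (hκQ : ∀ x y : complexBetti A.X 1,
      polarizationPairingOne A.X h (A.dim - 1) (pullbackOne A κ x) y =
        ε • polarizationPairingOne A.X h (A.dim - 1) x (pullbackOne A κ y))
    (hlink : ∀ (μ : ℂ) (v : complexBetti A.X 1), v ∈ Module.End.eigenspace (pullbackOne A ψ) μ →
      pullbackOne A κ v ∈ Module.End.eigenspace (pullbackOne A ψ) (π μ))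
    (hκ2 : ∀ μ : ℂ, ∃ c : ℂ, c ≠ 0 ∧ ∀ v ∈ Module.End.eigenspace (pullbackOne A ψ) μ,
      pullbackOne A κ (pullbackOne A κ v) = c • v)
    (hA0 : 0 < A.dim) {N : ℕ} (hXA : AbelianVariety.IsIsogenous X (A.powSucc N)) (p : ℕ)
    (x : complexBetti X.X (2 * p)) (hx : ∀ g ∈ specialLefschetzGroup X.dim X.X, g (2 * p) x = x) :
    x ∈ divisorClassesSpan X.X X.dim p :=
  specialLefschetzGroup_invariants_le_of_isIsogenous_of_exists hXA (dim_powSucc_pos hA0 N)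
    (exists_polarization_invariants_le_powSucc_of_quaternionDual ψ κ hC hdiag N₁ hn hQ hK π hπ hQπ hε hκQ hlink hκ2 hA0 N) p x hx

/-- **Cor. 4.5 as an equality of sets on the powers of an abelian variety with quaternionic multiplication in the CM
presentation**: the `S(A^{N+1})`-invariants of `H^{2p}(A^{N+1}(ℂ); ℂ)` are EXACTLY `Dᵖ_hom(A^{N+1})_ℂ` (the converse
inclusion is definitional, `apply_eq_self_of_mem_specialLefschetzGroup`).
[cite: Milne1999LefschetzClasses, Cor. 4.5 (p. 659)] -/
theorem setOf_forall_apply_eq_self_eq_divisorClassesSpan_powSucc_of_quaternionDual (ψ κ : A ⟶ A)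
    (hC : centralizerAlgebra A = Subalgebra.centralizer ℂ {pullbackOne A ψ, pullbackOne A κ})
    (hdiag : ⨆ μ : ℂ, Module.End.eigenspace (pullbackOne A ψ) μ = ⊤) (N₁ : ℕ)
    (hn : ∀ μ : ℂ, Module.End.HasEigenvalue (pullbackOne A ψ) μ →
      Module.finrank ℂ (Module.End.eigenspace (pullbackOne A ψ) μ) = N₁)
    {h : complexBetti A.X 2} (hQ : IsRationalClass h)
    (hK : ∃ s : ℝ, 0 < s ∧ IsKaehlerClass A.dim A.X ((s : ℂ) • h))
    (π : ℂ → ℂ) (hπ : ∀ μ : ℂ, Module.End.HasEigenvalue (pullbackOne A ψ) μ → π μ ≠ μ)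
    (hQπ : ∀ (μ μ' : ℂ) (v w : complexBetti A.X 1), v ∈ Module.End.eigenspace (pullbackOne A ψ) μ →
      w ∈ Module.End.eigenspace (pullbackOne A ψ) μ' → μ' ≠ π μ →
      polarizationPairingOne A.X h (A.dim - 1) v w = 0)
    {ε : ℂ} (hε : ε = 1 ∨ ε = -1)
    (hκQ : ∀ x y : complexBetti A.X 1,
      polarizationPairingOne A.X h (A.dim - 1) (pullbackOne A κ x) y =
        ε • polarizationPairingOne A.X h (A.dim - 1) x (pullbackOne A κ y))
    (hlink : ∀ (μ : ℂ) (v : complexBetti A.X 1), v ∈ Module.End.eigenspace (pullbackOne A ψ) μ →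
      pullbackOne A κ v ∈ Module.End.eigenspace (pullbackOne A ψ) (π μ))
    (hκ2 : ∀ μ : ℂ, ∃ c : ℂ, c ≠ 0 ∧ ∀ v ∈ Module.End.eigenspace (pullbackOne A ψ) μ,
      pullbackOne A κ (pullbackOne A κ v) = c • v)
    (N p : ℕ) :
    {x : complexBetti (A.powSucc N).X (2 * p) |
        ∀ g ∈ specialLefschetzGroup (A.powSucc N).dim (A.powSucc N).X, g (2 * p) x = x} =
      (divisorClassesSpan (A.powSucc N).X (A.powSucc N).dim p : Set _) :=
  Set.Subset.antisymm
    (fun x hx => specialLefschetzGroup_invariants_le_powSucc_of_quaternionDual ψ κ hC hdiag N₁ hn hQ hK π hπ hQπ hε hκQ hlink hκ2 N p x hx)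
    fun _ hx _ hg => apply_eq_self_of_mem_specialLefschetzGroup hg hx

/-- **Milne Prop. 4.8, (c) ⇒ (a) on every power of an abelian variety with quaternionic multiplication in
the CM presentation, record-free**: if `Hg′(A^{N+1}) = S(A^{N+1})` then `A^{N+1}` supports no exotic Hodge class (van Geemen's
`B(A^{N+1}) = D(A^{N+1})`). [cite: Milne1999LefschetzClasses, Prop. 4.8 and Cor. 4.5 (pp. 659–660)] -/
theorem isDivisorGenerated_powSucc_of_hodgeGroup_eq_specialLefschetzGroup_of_quaternionDual (ψ κ : A ⟶ A)
    (hC : centralizerAlgebra A = Subalgebra.centralizer ℂ {pullbackOne A ψ, pullbackOne A κ})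
    (hdiag : ⨆ μ : ℂ, Module.End.eigenspace (pullbackOne A ψ) μ = ⊤) (N₁ : ℕ)
    (hn : ∀ μ : ℂ, Module.End.HasEigenvalue (pullbackOne A ψ) μ →
      Module.finrank ℂ (Module.End.eigenspace (pullbackOne A ψ) μ) = N₁)
    {h : complexBetti A.X 2} (hQ : IsRationalClass h)
    (hK : ∃ s : ℝ, 0 < s ∧ IsKaehlerClass A.dim A.X ((s : ℂ) • h))
    (π : ℂ → ℂ) (hπ : ∀ μ : ℂ, Module.End.HasEigenvalue (pullbackOne A ψ) μ → π μ ≠ μ)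
    (hQπ : ∀ (μ μ' : ℂ) (v w : complexBetti A.X 1), v ∈ Module.End.eigenspace (pullbackOne A ψ) μ →
      w ∈ Module.End.eigenspace (pullbackOne A ψ) μ' → μ' ≠ π μ →
      polarizationPairingOne A.X h (A.dim - 1) v w = 0)
    {ε : ℂ} (hε : ε = 1 ∨ ε = -1)
    (hκQ : ∀ x y : complexBetti A.X 1,
      polarizationPairingOne A.X h (A.dim - 1) (pullbackOne A κ x) y =
        ε • polarizationPairingOne A.X h (A.dim - 1) x (pullbackOne A κ y))
    (hlink : ∀ (μ : ℂ) (v : complexBetti A.X 1), v ∈ Module.End.eigenspace (pullbackOne A ψ) μ →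
      pullbackOne A κ v ∈ Module.End.eigenspace (pullbackOne A ψ) (π μ))
    (hκ2 : ∀ μ : ℂ, ∃ c : ℂ, c ≠ 0 ∧ ∀ v ∈ Module.End.eigenspace (pullbackOne A ψ) μ,
      pullbackOne A κ (pullbackOne A κ v) = c • v)
    (N : ℕ)
    (hHg : hodgeGroup (A.powSucc N).dim (A.powSucc N).X =
      specialLefschetzGroup (A.powSucc N).dim (A.powSucc N).X) :
    IsDivisorGenerated (A.powSucc N) :=
  fun p c hc hpp => specialLefschetzGroup_invariants_le_powSucc_of_quaternionDual ψ κ hC hdiag N₁ hn hQ hK π hπ hQπ hε hκQ hlink hκ2 N p c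
    fun _ hg => apply_eq_self_of_mem_hodgeGroup (hHg ▸ hg) hc hpp

end Main

end Literature.AlgebraicGeometry.Milne1999
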